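import Summits.HodgeConjecture.HodgeConjecture.Theorems.F0P3cStCharTSRankOneHyp           -- ★ p849196 (this seat): HYP `exists_mem_unitaryGroup_eigenframe_of_valued_det_lt`
import Literature.NumberTheory.Rogawski1990.LocalNormFibreSurjectiveNonsplit             -- ★ `coe_localNonsplitEquiv_eq_map`
import Literature.NumberTheory.Automorphic.UnitaryGroupInertPlaceHyperbolicBasis          -- ★ `galAdicCompletionMap_galAdicCompletionMap_of_smul_eq`
import Literature.NumberTheory.Automorphic.UnitaryGroupNonsplitPlace                      -- ★ `LocalRing.eq_iff_apply_eq`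
import Literature.NumberTheory.Automorphic.GLnAdelicStructure                             -- ★ `glDiagonal`, `coe_glDiagonal`
import HarnessLib

/-!
# F0 · P3c · line LH6 «StCharTS» — road (D) «DEEP-FL», brick D3-iv-c₁ «ON THE STRATUM ⇒ A LEVI FRAME»: every `γ_H = (h₂, h₁) ∈ H_v` with `|det h₂|_w < |tr h₂|_w²` is
# `H_v`-CONJUGATE to an element of the diagonal Levi stratum, `(y γ_H y⁻¹).1 = glDiagonal 2 d′` — the socket `hyd'` of the ★ Levi machinery (S3-A ∕ S3-B ∕ (L2) ∕ (L3))

Cell `pub/hodgecm-mathlib`, crux H413 = `stmt-HodgeConjecture-24833` (`--supports` lane, helper), route HCCMUnconditional; seat LH6-p04 (g2), road (D) owner;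
status v3 `F0/P3b/LH6-p04/g2/ROAD-D.status.v3.txt` brick D3-iv (ON-stratum matching), part (c₁).  THEOREMS ONLY, sorry-free.  HONEST LABEL: HC_CM is proved only modulo the
7 printed citations (2 remaining: hLiu418 = stmt-HodgeConjecture-24832, h413 = stmt-HodgeConjecture-24833) until rung 0 closes; count-neutral.

WHY.  After ★ `isLocalDeltaTransfer_of_on` (p849417), ★ D3-iv-a (p849469) and D3-iv-b (p849509), the transfer statement D3 of road (D) is the scalar identity
`Φ([γ_H], f^H₀) = Δ‴(γ_H, c₀) · Φ(c₀, 𝟙_{K_n b K_n})` at `G`-regular ON-stratum `γ_H`.  Both sides are class functions of `γ_H` (★ `TransferFactorData.conj_left`,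
`ConjClasses.mk_eq_mk_iff_isConj`), so it suffices to check it on REPRESENTATIVES; this file supplies them in the shape the ★ Levi dictionaries take
(`hd' : glDiagonal 2 (LocalRing L v) d′ = γ_H.1.val`, cf. ★ `leviIntegrand_eq_signed`, ★ `isUnit_levi_of_isLocalGRegular_of_nonsplit`): THE HYPERBOLIC EIGENFRAME of ★ HYP,
read back on the CM carrier through the one-place model ★ `localNonsplitEquiv` and the injectivity of `x ↦ x_w` on `L ⊗ L⁺_v` at a non-split place (★ `LocalRing.eq_iff_apply_eq`).
[Rogawski1990, §3.6 p. 31 («the maximally split Cartan subgroup `T = M`»); §4.9 p. 56.]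

## References
* [Rogawski1990] J. D. Rogawski, *Automorphic Representations of Unitary Groups in Three Variables*, Ann. of Math. Stud. 123 (1990), §3.5–§3.6 pp. 29–31; §4.9 p. 56.
* [PlatonovRapinchuk1994] V. Platonov, A. Rapinchuk, *Algebraic Groups and Number Theory* (1994), §5.1 (the one-place model).
-/

set_option autoImplicit false
-- the mandated namespace has the single-problem summit's repeated segment (`HodgeConjecture.HodgeConjecture`)
set_option linter.dupNamespace false

noncomputable section

open Matrix Polynomial NumberField IsDedekindDomain
open scoped MatrixGroups
open Literature.NumberTheory.Rogawski1990 Literature.NumberTheory.Automorphic Literature.NumberTheory.Automorphic.UnitaryGroup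
open Literature.NumberTheory.GaloisRepresentations
open Literature.AlgebraicGeometry.ShimuraVarieties (unitaryGroup)

namespace Summit.HodgeConjecture.HodgeConjecture.Cruxes.H413.F0P3cStCharTSOnStratumLeviFrame

/-! ## §1 A diagonal invertible matrix is `glDiagonal` of units (no field structure needed) -/

section Diag

variable {R : Type*} [CommRing R]

/-- If `M ∈ GL₂(R)` has zero off-diagonal entries then its diagonal entries are units, with inverses the diagonal entries of `M⁻¹`. [folklore] -/
theorem mul_inv_apply_diag_eq_one (M : GL (Fin 2) R) (hoff : ∀ i j : Fin 2, i ≠ j → (M : Matrix (Fin 2) (Fin 2) R) i j = 0) (i : Fin 2) :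
    (M : Matrix (Fin 2) (Fin 2) R) i i * (M⁻¹ : GL (Fin 2) R) i i = 1 := by
  have hmul : (M : Matrix (Fin 2) (Fin 2) R) * ((M⁻¹ : GL (Fin 2) R) : Matrix (Fin 2) (Fin 2) R) = 1 := Units.mul_inv M
  fin_cases i
  · have h := congrFun (congrFun hmul 0) 0
    rw [Matrix.mul_apply, Fin.sum_univ_two, Matrix.one_apply_eq, hoff 0 1 (by decide), zero_mul, add_zero] at h
    exact h
  · have h := congrFun (congrFun hmul 1) 1
    rw [Matrix.mul_apply, Fin.sum_univ_two, Matrix.one_apply_eq, hoff 1 0 (by decide), zero_mul, zero_add] at h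
    exact h

/-- A diagonal `M ∈ GL₂(R)` is `glDiagonal 2 R d′` for the units `d′ᵢ = (Mᵢᵢ, (M⁻¹)ᵢᵢ)`. [folklore] -/
theorem exists_glDiagonal_eq (M : GL (Fin 2) R) (hoff : ∀ i j : Fin 2, i ≠ j → (M : Matrix (Fin 2) (Fin 2) R) i j = 0) :
    ∃ d' : Fin 2 → Rˣ, glDiagonal 2 R d' = M ∧ ∀ i, ((d' i : Rˣ) : R) = (M : Matrix (Fin 2) (Fin 2) R) i i := by
  refine ⟨fun i => ⟨(M : Matrix (Fin 2) (Fin 2) R) i i, ((M⁻¹ : GL (Fin 2) R) : Matrix (Fin 2) (Fin 2) R) i i, mul_inv_apply_diag_eq_one M hoff i,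
    by rw [mul_comm]; exact mul_inv_apply_diag_eq_one M hoff i⟩, ?_, fun i => rfl⟩
  apply Units.ext
  rw [coe_glDiagonal]
  ext i j
  by_cases hij : i = j
  · subst hij; rw [Matrix.diagonal_apply_eq]
  · rw [Matrix.diagonal_apply_ne _ hij, hoff i j hij]

end Diag

/-! ## §2 ON the stratum ⇒ a Levi frame, on the CM carriers -/

section CM

variable (L : Type) [Field L] [NumberField L] [IsCMField L] (v : HeightOneSpectrum (𝓞 ↥(maximalRealSubfield L)))
  (w : PlacesOver L v) (hw : IsCMField.complexConj L • w.1 = w.1)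

include hw in
set_option maxHeartbeats 800000 in  -- statement-level `whnf` on the CM carriers
/-- **D3-iv-c₁ «ON THE STRATUM ⇒ A LEVI FRAME».**  For `γ_H = (h₂, h₁) ∈ H_v = U(Φ₂)_v × U(Φ₁)_v` at a non-split `v` with `|det h₂|_w < |tr h₂|_w²` there are `y ∈ H_v` and units
`d′ : Fin 2 → (L ⊗ L⁺_v)ˣ` with `(y γ_H y⁻¹).1 = glDiagonal 2 d′` (the ★ Levi socket `hyd'`), and moreover `|d′₀|_w = |tr h₂|_w > |d′₁|_w` and `σ_w(d′₀,w) · d′₁,w = 1`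
(the hyperbolic relation). [cite: Rogawski1990, §3.6 p. 31; §4.9 p. 56] [cite: PlatonovRapinchuk1994, §5.1] -/
theorem exists_conj_fst_eq_glDiagonal_of_on
    (γH : ((cmDatum L 2 (Matrix.of fun i j : Fin 2 => if i.val + j.val + 1 = 2 then (1 : L) else 0)).Local v ×
      (cmDatum L 1 (Matrix.of fun i j : Fin 1 => if i.val + j.val + 1 = 1 then (1 : L) else 0)).Local v))
    (hon : Valued.v ((Pi.evalRingHom (fun w' : PlacesOver L v => w'.1.adicCompletion L) w) ((γH.1.val : GL (Fin 2) (LocalRing L v)) : Matrix (Fin 2) (Fin 2) (LocalRing L v)).det) <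
      Valued.v ((Pi.evalRingHom (fun w' : PlacesOver L v => w'.1.adicCompletion L) w) ((γH.1.val : GL (Fin 2) (LocalRing L v)) : Matrix (Fin 2) (Fin 2) (LocalRing L v)).trace) ^ 2) :
    ∃ (y : ((cmDatum L 2 (Matrix.of fun i j : Fin 2 => if i.val + j.val + 1 = 2 then (1 : L) else 0)).Local v ×
      (cmDatum L 1 (Matrix.of fun i j : Fin 1 => if i.val + j.val + 1 = 1 then (1 : L) else 0)).Local v)) (d' : Fin 2 → (LocalRing L v)ˣ),
      glDiagonal 2 (LocalRing L v) d' = (((y * γH * y⁻¹).1).val : GL (Fin 2) (LocalRing L v)) ∧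
      Valued.v (((d' 0 : (LocalRing L v)ˣ) : LocalRing L v) w) =
        Valued.v ((Pi.evalRingHom (fun w' : PlacesOver L v => w'.1.adicCompletion L) w) ((γH.1.val : GL (Fin 2) (LocalRing L v)) : Matrix (Fin 2) (Fin 2) (LocalRing L v)).trace) ∧
      Valued.v (((d' 1 : (LocalRing L v)ˣ) : LocalRing L v) w) < Valued.v (((d' 0 : (LocalRing L v)ˣ) : LocalRing L v) w) ∧
      galAdicCompletionMap (L := L) (IsCMField.complexConj L) hw (((d' 0 : (LocalRing L v)ˣ) : LocalRing L v) w) * ((d' 1 : (LocalRing L v)ˣ) : LocalRing L v) w = 1 := by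
  haveI : Algebra.IsQuadraticExtension ↥(maximalRealSubfield L) L := IsCMField.isQuadraticExtension L
  set ev := Pi.evalRingHom (fun w' : PlacesOver L v => w'.1.adicCompletion L) w with hev
  set σw := galAdicCompletionMap (L := L) (IsCMField.complexConj L) hw with hσw
  have hσσ : ∀ r, σw (σw r) = r := fun r => galAdicCompletionMap_galAdicCompletionMap_of_smul_eq (IsCMField.complexConj L) w (IsCMField.complexConj_ne_one L) hw r
  have hσv : ∀ x, Valued.v (σw x) = Valued.v x := fun x => valued_galAdicCompletionMap (L := L) (IsCMField.complexConj L) hw x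
  set E₂ : (cmDatum L 2 (Matrix.of fun i j : Fin 2 => if i.val + j.val + 1 = 2 then (1 : L) else 0)).Local v ≃ₜ* ↥(unitaryGroupOfForm σw (placeForm (Matrix.of fun i j : Fin 2 => if i.val + j.val + 1 = 2 then (1 : L) else 0) w.1)) :=
    localNonsplitEquiv (IsCMField.complexConj L) (Matrix.of fun i j : Fin 2 => if i.val + j.val + 1 = 2 then (1 : L) else 0) (IsCMField.complexConj_ne_one L) w hw with hE₂
  have hΦ : placeForm (Matrix.of fun i j : Fin 2 => if i.val + j.val + 1 = 2 then (1 : L) else 0) w.1 = Matrix.of fun i j : Fin 2 => if i.val + j.val + 1 = 2 then (1 : w.1.adicCompletion L) else 0 := by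
    ext i j
    simp only [placeForm, Matrix.map_apply, Matrix.of_apply]
    split_ifs <;> simp
  -- the model element and its hyperbolic unitary eigenframe (★ HYP)
  have hmem : ((E₂ γH.1 : ↥(unitaryGroupOfForm σw (placeForm (Matrix.of fun i j : Fin 2 => if i.val + j.val + 1 = 2 then (1 : L) else 0) w.1))) : GL (Fin 2) (w.1.adicCompletion L)) ∈
      unitaryGroup σw (Matrix.of fun i j : Fin 2 => if i.val + j.val + 1 = 2 then (1 : w.1.adicCompletion L) else 0) := by
    have h2 := mem_unitaryGroupOfForm_iff.1 (E₂ γH.1).2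
    refine Literature.AlgebraicGeometry.ShimuraVarieties.mem_unitaryGroup_iff.2 ?_
    rw [← hΦ]
    exact h2
  have hcoe : (((E₂ γH.1 : ↥(unitaryGroupOfForm σw (placeForm (Matrix.of fun i j : Fin 2 => if i.val + j.val + 1 = 2 then (1 : L) else 0) w.1))) : GL (Fin 2) (w.1.adicCompletion L)) : Matrix (Fin 2) (Fin 2) (w.1.adicCompletion L)) =
      ((γH.1.val : GL (Fin 2) (LocalRing L v)) : Matrix (Fin 2) (Fin 2) (LocalRing L v)).map ev :=
    coe_localNonsplitEquiv_eq_map L v w hw (N := 2) (H := (Matrix.of fun i j : Fin 2 => if i.val + j.val + 1 = 2 then (1 : L) else 0)) γH.1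
  have hdet : (((E₂ γH.1 : ↥(unitaryGroupOfForm σw (placeForm (Matrix.of fun i j : Fin 2 => if i.val + j.val + 1 = 2 then (1 : L) else 0) w.1))) : GL (Fin 2) (w.1.adicCompletion L)) : Matrix (Fin 2) (Fin 2) (w.1.adicCompletion L)).det =
      ev ((γH.1.val : GL (Fin 2) (LocalRing L v)) : Matrix (Fin 2) (Fin 2) (LocalRing L v)).det := by
    rw [hcoe, ← RingHom.mapMatrix_apply, ← RingHom.map_det]
  have htr : (((E₂ γH.1 : ↥(unitaryGroupOfForm σw (placeForm (Matrix.of fun i j : Fin 2 => if i.val + j.val + 1 = 2 then (1 : L) else 0) w.1))) : GL (Fin 2) (w.1.adicCompletion L)) : Matrix (Fin 2) (Fin 2) (w.1.adicCompletion L)).trace =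
      ev ((γH.1.val : GL (Fin 2) (LocalRing L v)) : Matrix (Fin 2) (Fin 2) (LocalRing L v)).trace := by
    rw [hcoe, Matrix.trace, Matrix.trace, map_sum]
    rfl
  have hon' : Valued.v (((E₂ γH.1 : ↥(unitaryGroupOfForm σw (placeForm (Matrix.of fun i j : Fin 2 => if i.val + j.val + 1 = 2 then (1 : L) else 0) w.1))) : GL (Fin 2) (w.1.adicCompletion L)) : Matrix (Fin 2) (Fin 2) (w.1.adicCompletion L)).det <
      Valued.v (((E₂ γH.1 : ↥(unitaryGroupOfForm σw (placeForm (Matrix.of fun i j : Fin 2 => if i.val + j.val + 1 = 2 then (1 : L) else 0) w.1))) : GL (Fin 2) (w.1.adicCompletion L)) : Matrix (Fin 2) (Fin 2) (w.1.adicCompletion L)).trace ^ 2 := by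
    rw [hdet, htr]
    exact hon
  obtain ⟨Q, u, hQ, -, hQP, hv0, hv1, h01⟩ :=
    F0P3cStCharTSRankOneHyp.exists_mem_unitaryGroup_eigenframe_of_valued_det_lt w.1 σw hσσ hσv hmem hon'
  -- `Q` as an element of `U(Φ₂)_v` and the conjugate `q⁻¹ h₂ q`
  have hQmem : Q ∈ unitaryGroupOfForm σw (placeForm (Matrix.of fun i j : Fin 2 => if i.val + j.val + 1 = 2 then (1 : L) else 0) w.1) := by
    have h2 := Literature.AlgebraicGeometry.ShimuraVarieties.mem_unitaryGroup_iff.1 hQ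
    refine mem_unitaryGroupOfForm_iff.2 ?_
    rw [hΦ]
    exact h2
  set q : (cmDatum L 2 (Matrix.of fun i j : Fin 2 => if i.val + j.val + 1 = 2 then (1 : L) else 0)).Local v := E₂.symm ⟨Q, hQmem⟩ with hq
  have hEq : E₂ q = ⟨Q, hQmem⟩ := by rw [hq, ContinuousMulEquiv.apply_symm_apply]
  -- the matrix of the conjugate, read at `w`, is `diag(u)`
  set M : GL (Fin 2) (LocalRing L v) := ((q⁻¹ * γH.1 * q).val : GL (Fin 2) (LocalRing L v)) with hM
  have hMw : ((M : Matrix (Fin 2) (Fin 2) (LocalRing L v))).map ev = diagonal u := by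
    have h1 : ((M : Matrix (Fin 2) (Fin 2) (LocalRing L v))).map ev =
        (((E₂ (q⁻¹ * γH.1 * q) : ↥(unitaryGroupOfForm σw (placeForm (Matrix.of fun i j : Fin 2 => if i.val + j.val + 1 = 2 then (1 : L) else 0) w.1))) : GL (Fin 2) (w.1.adicCompletion L)) : Matrix (Fin 2) (Fin 2) (w.1.adicCompletion L)) :=
      (coe_localNonsplitEquiv_eq_map L v w hw (N := 2) (H := (Matrix.of fun i j : Fin 2 => if i.val + j.val + 1 = 2 then (1 : L) else 0)) (q⁻¹ * γH.1 * q)).symm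
    rw [h1, map_mul, map_mul, map_inv, hEq, Subgroup.coe_mul, Subgroup.coe_mul, Subgroup.coe_inv, Units.val_mul, Units.val_mul, Matrix.coe_units_inv]
    change (Q.val)⁻¹ * (((E₂ γH.1 : ↥(unitaryGroupOfForm σw (placeForm (Matrix.of fun i j : Fin 2 => if i.val + j.val + 1 = 2 then (1 : L) else 0) w.1))) : GL (Fin 2) (w.1.adicCompletion L)) : Matrix (Fin 2) (Fin 2) (w.1.adicCompletion L)) * Q.val = diagonal u
    rw [Matrix.mul_assoc, hQP, ← Matrix.mul_assoc, Matrix.nonsing_inv_mul _ ((Matrix.isUnit_iff_isUnit_det _).1 Q.isUnit), Matrix.one_mul]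
  have hMapply : ∀ i j, ((M : Matrix (Fin 2) (Fin 2) (LocalRing L v)) i j) w = diagonal u i j := fun i j => by
    have := congrFun (congrFun hMw i) j
    rw [Matrix.map_apply] at this
    exact this
  have hoff : ∀ i j : Fin 2, i ≠ j → (M : Matrix (Fin 2) (Fin 2) (LocalRing L v)) i j = 0 := fun i j hij => by
    rw [LocalRing.eq_iff_apply_eq (IsCMField.complexConj L) (IsCMField.complexConj_ne_one L) w hw, hMapply, Matrix.diagonal_apply_ne _ hij]
    rfl
  obtain ⟨d', hd', hd'i⟩ := exists_glDiagonal_eq M hoff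
  refine ⟨(q⁻¹, 1), d', ?_, ?_, ?_, ?_⟩
  · rw [hd', hM]
    simp only [Prod.fst_mul, Prod.fst_inv, inv_inv]
  · rw [hd'i, hMapply, Matrix.diagonal_apply_eq, hv0, htr]
  · rw [hd'i, hd'i, hMapply, hMapply, Matrix.diagonal_apply_eq, Matrix.diagonal_apply_eq]
    exact hv1
  · rw [hd'i, hd'i, hMapply, hMapply, Matrix.diagonal_apply_eq, Matrix.diagonal_apply_eq]
    exact h01

end CM

end Summit.HodgeConjecture.HodgeConjecture.Cruxes.H413.F0P3cStCharTSOnStratumLeviFrame
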